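import Summits.Ventures.QEC.Decoders.HGPOptimalRadius
import HarnessLib

/-!
# Ventures/QEC — Decoders/HGPFamilyOptimalRadius: the optimal correction radius of a hypergraph-product code FAMILY-wide,
# from the four classical seed certificates (Tillich–Zémor Thm 7 / Thm 9 / Lemma 10) — Q4 «theorem for families», HP

LADDER-QEC (venture cell `qec`), PARTITION row 08, rung Q4, label «theorem for families» (qec-lead block 11 (3)). The
per-row files `Decoders/HGPOptimalRadiusNN.lean` instantiate `HGP.hasOptimalRadius_flat` on 1 140 census rows; this file
states the same consequence ONCE for the whole family, with the classical data as hypotheses — exactly the hypotheses of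
qec-type-04's census corollaries `Summit.Ventures.QEC.HGP.isCode_of_le_transpose` / `isCode_of_transpose_le` /
`isCode_of_min_min` (Basic/HypergraphProductCensus.lean: seed ranks `rᵢ`, classical distances `dᵢ = d(ker Hᵢ)`,
`eᵢ = d(ker Hᵢᵀ)`, and the regime comparison), so that any future HGP row or seed family gets its radius entry by one
application:

* flat code (qubits `Fin (n₁n₂ + m₁m₂)`, seeds given as row lists — the census presentation), Pauli level:
  `hasOptimalRadius_flat_of_le_transpose` / `_of_transpose_le` / `_of_min_min` —
  `(hgpFlatCode n₁ n₂ H₁ H₂).HasOptimalRadius ⌊(d − 1)/2⌋` with `d = min(d₁,d₂)`, resp. `min(e₁,e₂)`, resp.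
  `min(d₁,d₂,e₁,e₂)`: SOME Pauli decoder (sector-wise minimum-weight decoding) has correction radius EXACTLY `⌊(d−1)/2⌋`
  and NO Pauli decoder whatsoever corrects every error of weight `⌊(d−1)/2⌋ + 1`;
* structured code `HGP.code H₁ H₂` (qubits `(Fin n₁ × Fin n₂) ⊕ (Fin m₁ × Fin m₂)`, arbitrary seed matrices), sector level,
  main regime `min(d₁,d₂) ≤ e₁, e₂`: `minWeight_correctsUpToX_of_le_transpose` / `…Z…` (minimum-weight sector decoding
  corrects `⌊(d−1)/2⌋` bit flips and `⌊(d−1)/2⌋` phase flips) and `le_half_of_correctsUpTo_sectors_of_le_transpose` (no PAIR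
  of sector decoders both correct `⌊(d−1)/2⌋ + 1`).

TIER: CERTIFIED, KERNEL-std — pure corollaries (no `decide`, no data), axioms ⊆ {propext, Classical.choice, Quot.sound}.
HONEST FRAMING: method = theorem; the attaining decoder is minimum-weight decoding as a specified function (explicit decoder
tables are the kernel-table lane; float decoders are COMPUTED/VALIDATED rows); nothing probabilistic; the printed TZ theorem
itself is proved upstream (type-04 / Literature HypergraphProductDistance), not here.

References: [TillichZemor2014] Thm 7, Thm 9, Lemma 10 (arXiv v1 chunks p0007 L126-135, p0008 L11-15, L57-62);
[Gottesman1997] §2.3 (chunk p0014 L3); [DelfosseNickerson2021] §3 ¶2 (chunk p0006 L8–13).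
-/

namespace Summit.Ventures.QEC.Census.HGP

open Matrix Literature.InformationTheory.QuantumCodes
open Literature.InformationTheory.Coding (minDist)

/-! ## Flat code, Pauli level: the three Tillich–Zémor regimes -/

/-- **HGP family, regime `min(d₁,d₂) ≤ e₁, e₂`** (e.g. both seeds of full row rank): from the seed certificates
`rank Hᵢ = rᵢ`, `d(ker Hᵢ) = dᵢ`, the comparisons `min(d₁,d₂) ≤ d(ker Hᵢᵀ)` and the numeral identities, the flat code
of `HGP(H₁,H₂)` has OPTIMAL correction radius `t = ⌊(min(d₁,d₂) − 1)/2⌋` — attained by sector-wise minimum-weight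
decoding, unbeatable by any Pauli decoder. [cite: TillichZemor2014, Thm 9 and Lemma 10 (arXiv v1 chunk p0008 L11-15, L57-62)] [cite: Gottesman1997, §2.3 (chunk p0014 L3)] -/
theorem hasOptimalRadius_flat_of_le_transpose (n₁ n₂ : ℕ) (H₁ H₂ : List ℕ) {r₁ r₂ d₁ d₂ n k d t : ℕ}
    (hr₁ : (rowMatrix n₁ H₁).rank = r₁) (hr₂ : (rowMatrix n₂ H₂).rank = r₂)
    (hd₁ : minDist (pcCode (rowMatrix n₁ H₁)) = d₁) (hd₂ : minDist (pcCode (rowMatrix n₂ H₂)) = d₂)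
    (ht₁ : ((min d₁ d₂ : ℕ) : ℕ∞) ≤ minDist (pcCode (rowMatrix n₁ H₁)ᵀ))
    (ht₂ : ((min d₁ d₂ : ℕ) : ℕ∞) ≤ minDist (pcCode (rowMatrix n₂ H₂)ᵀ))
    (hn : n₁ * n₂ + H₁.length * H₂.length = n) (hk : (n₁ - r₁) * (n₂ - r₂) + (H₁.length - r₁) * (H₂.length - r₂) = k)
    (hd : min d₁ d₂ = d) (ht : (d - 1) / 2 = t) :
    (hgpFlatCode n₁ n₂ H₁ H₂).HasOptimalRadius t :=
  HGP.hasOptimalRadius_flat n₁ n₂ H₁ H₂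
    (Summit.Ventures.QEC.HGP.isCode_of_le_transpose _ _ hr₁ hr₂ hd₁ hd₂ ht₁ ht₂ hn hk hd) ht

/-- **HGP family, dual regime `min(e₁,e₂) ≤ d₁, d₂`**: optimal correction radius `⌊(min(e₁,e₂) − 1)/2⌋` of the flat code,
`eᵢ = d(ker Hᵢᵀ)`. [cite: TillichZemor2014, Thm 9 and Lemma 10 (arXiv v1 chunk p0008 L11-15, L57-62)] [cite: Gottesman1997, §2.3 (chunk p0014 L3)] -/
theorem hasOptimalRadius_flat_of_transpose_le (n₁ n₂ : ℕ) (H₁ H₂ : List ℕ) {r₁ r₂ e₁ e₂ n k d t : ℕ}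
    (hr₁ : (rowMatrix n₁ H₁).rank = r₁) (hr₂ : (rowMatrix n₂ H₂).rank = r₂)
    (he₁ : minDist (pcCode (rowMatrix n₁ H₁)ᵀ) = e₁) (he₂ : minDist (pcCode (rowMatrix n₂ H₂)ᵀ) = e₂)
    (ht₁ : ((min e₁ e₂ : ℕ) : ℕ∞) ≤ minDist (pcCode (rowMatrix n₁ H₁)))
    (ht₂ : ((min e₁ e₂ : ℕ) : ℕ∞) ≤ minDist (pcCode (rowMatrix n₂ H₂)))
    (hn : n₁ * n₂ + H₁.length * H₂.length = n) (hk : (n₁ - r₁) * (n₂ - r₂) + (H₁.length - r₁) * (H₂.length - r₂) = k)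
    (hd : min e₁ e₂ = d) (ht : (d - 1) / 2 = t) :
    (hgpFlatCode n₁ n₂ H₁ H₂).HasOptimalRadius t :=
  HGP.hasOptimalRadius_flat n₁ n₂ H₁ H₂
    (Summit.Ventures.QEC.HGP.isCode_of_transpose_le _ _ hr₁ hr₂ he₁ he₂ ht₁ ht₂ hn hk hd) ht

/-- **HGP family, all four classical codes nonzero**: optimal correction radius `⌊(min(d₁,d₂,e₁,e₂) − 1)/2⌋` of the flat
code. [cite: TillichZemor2014, Thm 9 and Lemma 10 (arXiv v1 chunk p0008 L11-15, L57-62)] [cite: Gottesman1997, §2.3 (chunk p0014 L3)] -/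
theorem hasOptimalRadius_flat_of_min_min (n₁ n₂ : ℕ) (H₁ H₂ : List ℕ) {r₁ r₂ d₁ d₂ e₁ e₂ n k d t : ℕ}
    (hr₁ : (rowMatrix n₁ H₁).rank = r₁) (hr₂ : (rowMatrix n₂ H₂).rank = r₂)
    (hd₁ : minDist (pcCode (rowMatrix n₁ H₁)) = d₁) (hd₂ : minDist (pcCode (rowMatrix n₂ H₂)) = d₂)
    (he₁ : minDist (pcCode (rowMatrix n₁ H₁)ᵀ) = e₁) (he₂ : minDist (pcCode (rowMatrix n₂ H₂)ᵀ) = e₂)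
    (hn : n₁ * n₂ + H₁.length * H₂.length = n) (hk : (n₁ - r₁) * (n₂ - r₂) + (H₁.length - r₁) * (H₂.length - r₂) = k)
    (hd : min (min d₁ d₂) (min e₁ e₂) = d) (ht : (d - 1) / 2 = t) :
    (hgpFlatCode n₁ n₂ H₁ H₂).HasOptimalRadius t :=
  HGP.hasOptimalRadius_flat n₁ n₂ H₁ H₂
    (Summit.Ventures.QEC.HGP.isCode_of_min_min _ _ hr₁ hr₂ hd₁ hd₂ he₁ he₂ hn hk hd) ht

/-! ## Structured code, sector level (arbitrary seed matrices), main regime -/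

section Structured

variable {m₁ n₁ m₂ n₂ : ℕ}

/-- **HGP family, structured code, `X`-sector**: in the regime `min(d₁,d₂) ≤ e₁, e₂`, minimum-weight `X`-decoding of
`HGP.code H₁ H₂` (qubits `(Fin n₁ × Fin n₂) ⊕ (Fin m₁ × Fin m₂)`) corrects every bit-flip pattern of weight
`≤ ⌊(min(d₁,d₂) − 1)/2⌋`. [cite: TillichZemor2014, Thm 9 (arXiv v1 chunk p0008 L11-15)] [cite: DelfosseNickerson2021, §3 ¶2 (chunk p0006 L8–9)] -/
theorem minWeight_correctsUpToX_of_le_transpose (H₁ : Matrix (Fin m₁) (Fin n₁) (ZMod 2))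
    (H₂ : Matrix (Fin m₂) (Fin n₂) (ZMod 2)) {r₁ r₂ d₁ d₂ n k d : ℕ} (hr₁ : H₁.rank = r₁) (hr₂ : H₂.rank = r₂)
    (hd₁ : minDist (pcCode H₁) = d₁) (hd₂ : minDist (pcCode H₂) = d₂)
    (ht₁ : ((min d₁ d₂ : ℕ) : ℕ∞) ≤ minDist (pcCode H₁ᵀ)) (ht₂ : ((min d₁ d₂ : ℕ) : ℕ∞) ≤ minDist (pcCode H₂ᵀ))
    (hn : n₁ * n₂ + m₁ * m₂ = n) (hk : (n₁ - r₁) * (n₂ - r₂) + (m₁ - r₁) * (m₂ - r₂) = k) (hd : min d₁ d₂ = d) :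
    (Decoder.minWeight (Summit.Ventures.QEC.HGP.code H₁ H₂).xSyndrome hammingNorm).CorrectsUpTo
      (Summit.Ventures.QEC.HGP.code H₁ H₂).xSyndrome
      ((Summit.Ventures.QEC.HGP.code H₁ H₂).rowSpX : Set ((Fin n₁ × Fin n₂) ⊕ (Fin m₁ × Fin m₂) → ZMod 2))
      hammingNorm ((d - 1) / 2) :=
  (Summit.Ventures.QEC.HGP.isCode_of_le_transpose H₁ H₂ hr₁ hr₂ hd₁ hd₂ ht₁ ht₂ hn hk hd).minWeight_correctsUpToX

/-- **HGP family, structured code, `Z`-sector**: minimum-weight `Z`-decoding corrects every phase-flip pattern of weight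
`≤ ⌊(min(d₁,d₂) − 1)/2⌋` (same regime). [cite: TillichZemor2014, Thm 9 (arXiv v1 chunk p0008 L11-15)] [cite: DelfosseNickerson2021, §3 ¶2 (chunk p0006 L8–9)] -/
theorem minWeight_correctsUpToZ_of_le_transpose (H₁ : Matrix (Fin m₁) (Fin n₁) (ZMod 2))
    (H₂ : Matrix (Fin m₂) (Fin n₂) (ZMod 2)) {r₁ r₂ d₁ d₂ n k d : ℕ} (hr₁ : H₁.rank = r₁) (hr₂ : H₂.rank = r₂)
    (hd₁ : minDist (pcCode H₁) = d₁) (hd₂ : minDist (pcCode H₂) = d₂)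
    (ht₁ : ((min d₁ d₂ : ℕ) : ℕ∞) ≤ minDist (pcCode H₁ᵀ)) (ht₂ : ((min d₁ d₂ : ℕ) : ℕ∞) ≤ minDist (pcCode H₂ᵀ))
    (hn : n₁ * n₂ + m₁ * m₂ = n) (hk : (n₁ - r₁) * (n₂ - r₂) + (m₁ - r₁) * (m₂ - r₂) = k) (hd : min d₁ d₂ = d) :
    (Decoder.minWeight (Summit.Ventures.QEC.HGP.code H₁ H₂).zSyndrome hammingNorm).CorrectsUpTo
      (Summit.Ventures.QEC.HGP.code H₁ H₂).zSyndrome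
      ((Summit.Ventures.QEC.HGP.code H₁ H₂).rowSpZ : Set ((Fin n₁ × Fin n₂) ⊕ (Fin m₁ × Fin m₂) → ZMod 2))
      hammingNorm ((d - 1) / 2) :=
  (Summit.Ventures.QEC.HGP.isCode_of_le_transpose H₁ H₂ hr₁ hr₂ hd₁ hd₂ ht₁ ht₂ hn hk hd).minWeight_correctsUpToZ

/-- **HGP family, structured code, tightness**: in the same regime no PAIR of sector decoders of `HGP.code H₁ H₂` (any
function of the `Z`-check syndrome for bit flips, any function of the `X`-check syndrome for phase flips) both correct every
pattern of weight `t` when `t > ⌊(min(d₁,d₂) − 1)/2⌋`. [cite: DelfosseNickerson2021, §3 ¶2 (chunk p0006 L12–13: "both of these bounds are tight")] -/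
theorem le_half_of_correctsUpTo_sectors_of_le_transpose (H₁ : Matrix (Fin m₁) (Fin n₁) (ZMod 2))
    (H₂ : Matrix (Fin m₂) (Fin n₂) (ZMod 2)) {r₁ r₂ d₁ d₂ n k d : ℕ} (hr₁ : H₁.rank = r₁) (hr₂ : H₂.rank = r₂)
    (hd₁ : minDist (pcCode H₁) = d₁) (hd₂ : minDist (pcCode H₂) = d₂)
    (ht₁ : ((min d₁ d₂ : ℕ) : ℕ∞) ≤ minDist (pcCode H₁ᵀ)) (ht₂ : ((min d₁ d₂ : ℕ) : ℕ∞) ≤ minDist (pcCode H₂ᵀ))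
    (hn : n₁ * n₂ + m₁ * m₂ = n) (hk : (n₁ - r₁) * (n₂ - r₂) + (m₁ - r₁) * (m₂ - r₂) = k) (hd : min d₁ d₂ = d)
    {DX : Decoder (Fin n₁ × Fin m₂ → ZMod 2) ((Fin n₁ × Fin n₂) ⊕ (Fin m₁ × Fin m₂) → ZMod 2)}
    {DZ : Decoder (Fin m₁ × Fin n₂ → ZMod 2) ((Fin n₁ × Fin n₂) ⊕ (Fin m₁ × Fin m₂) → ZMod 2)} {t : ℕ}
    (hDX : DX.CorrectsUpTo (Summit.Ventures.QEC.HGP.code H₁ H₂).xSyndrome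
      ((Summit.Ventures.QEC.HGP.code H₁ H₂).rowSpX : Set ((Fin n₁ × Fin n₂) ⊕ (Fin m₁ × Fin m₂) → ZMod 2))
      hammingNorm t)
    (hDZ : DZ.CorrectsUpTo (Summit.Ventures.QEC.HGP.code H₁ H₂).zSyndrome
      ((Summit.Ventures.QEC.HGP.code H₁ H₂).rowSpZ : Set ((Fin n₁ × Fin n₂) ⊕ (Fin m₁ × Fin m₂) → ZMod 2))
      hammingNorm t) :
    t ≤ (d - 1) / 2 :=
  (Summit.Ventures.QEC.HGP.isCode_of_le_transpose H₁ H₂ hr₁ hr₂ hd₁ hd₂ ht₁ ht₂ hn hk hd).le_half_of_correctsUpTo_sectors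
    hDX hDZ

end Structured

end Summit.Ventures.QEC.Census.HGP
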